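import Summits.QuantumFields.YangMills.Theorems.BalabanUVNodesN09AxialSelectionExists
import Literature.MathematicalPhysics.QuantumFieldTheory.Balaban1983to89.Node00.ShearedAveragingRecord
import HarnessLib

/-!
# DAG node N07 [B11] — Sect. F's FIRST STEP at the record, generic: EVERY RESIDUAL ORBIT OF LEVEL `j` CONTAINS A CONFIGURATION WHOSE AVERAGES `M^i`, `i < j`,
# ARE ALL BLOCK-AXIAL (any averaging family, any contour family, any gauge group) — the A6 supplier of the `hax` binders of `Node00.ShearedAveragingFlat` ∕
# `…PureGauge` ∕ `…Record` ∕ `…RecordPureGauge`; and on such an axial tower the intrinsic factor `S_j` is trivial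

Cell `pub-ymgap` (HUMAN RULINGS D-0062 ∕ D-0088 ∕ D-0149), width seat `pub-ymgap-dag-n07-w6` g0 (second wave), 2026-08-28; CLAIM-3 ∕ INTENT-3 (cell bus).  `--kind proof
--supports stmt-QuantumFields-20542 --as helper` (K1⁷; count-neutral).  THEOREMS ONLY.

THE PRINT.  [B11] = T. Bałaban, *The variational problem and background fields in renormalization group method for lattice gauge theories*, Commun. Math. Phys. **102**
(1985) 277–309 `[Balaban1985Variational]`, p. 300 (Sect. F, first step): «Now we repeat all the constructions of the Sect. F in [6]. Applying a gauge transformation to U_k we get a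
configuration U′_k such, that U′_k ∈ Ax_k(□̃(k), 1), and U′_k satisfies the generalized axial gauge conditions on □̃(k).»  [6] = T. Bałaban, *Spaces of regular gauge field
configurations on a lattice and gauge fixing conditions*, Commun. Math. Phys. **99** (1985) 75–102 `[Balaban1985RegularSpaces]`, (1.14)–(1.15) p. 78: «An axial gauge is defined by
the equations for x_j ∈ Λ_j, j = 1, …, k, we put Ū^{j−1}(Γ_{x_j,x_{j−1}}) = 1 for x_{j−1} ∈ B(x_j), Ū^{j−2}(Γ_{x_{j−1},x_{j−2}}) = 1 for x_{j−2} ∈ B(x_{j−1}), …, U(Γ_{x₁,x}) = 1 for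
x ∈ B(x₁). (1.15) It is easy to see that these equations together with (1.14) for gauge transformations determine uniquely an element in each orbit.»  [I] = [Balaban1987RG1]
p. 256 (0.21): the residual gauge transformations «u = 1 on T^{(k)}» (`B12GaugeOrbits021.IsResidual`).

WHAT THIS FILE DOES (kernel gauge algebra BY NAME over dag-n09-w2's one-level theorems; NOTHING of [B11]∕[6] analysis asserted).
* §1 (generic `P`, `G`, `av : ∀ i, Averaging P i G`, `cd : ∀ i, ContourData P i G`): `axialTower_gaugeAct_blockLift` — a block-constant lift `ū` from level `j` (r15's `blockLift`)
  PRESERVES the block axial gauges of `M^i`, `i < j` (induction on `j` through `blockLift_succ`: one level of `liftTransf` at a time, dag-n09-w2's `axialGauge_gaugeAct_liftTransf` +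
  `iter_gaugeAct_blockLift`); ★★ `exists_residual_axialTower` — THE EXISTENCE HALF OF (1.15) WITH (1.14), all levels `< j` at once, in the single-domain reading (all of each torus):
  `∀ j ≤ m + K, ∀ U, ∃ w, IsResidual j w ∧ ∀ i < j, AxialGauge (cd i) (M^i(U^w))` — induction: dag-n09-w2's `exists_residual_iter_axial` ONE level at a time on top of the tower
  already fixed, the new fine transformation lifted by `blockLift` (residual by `isResidual_blockLift_of_fine`, harmless below by §1); `exists_axialTower` (without the residual clause).
  Twins in the tree with OTHER objects (not importable ∕ not restated): `B8Eq115HierAxialTorus.exists_gaugeAct_hierAx` (U(1), the BIJ (2.10) average, tree gauge `δ_{Ax}`) and N05's `ℤᵈ`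
  `B7Eq84Concrete.gaugeFixing_exists` ([3]'s corner averaging).  UNIQUENESS: ★ `eq_one_of_residual_of_axialTower` (a residual `w` carrying an axial tower to an axial tower is `1`,
  downward induction on dag-n09-w2's one-level `eq_one_of_fine_of_axialGauge`), `axialTower_unique_of_orbitRel`, ★★ `existsUnique_axialTower_in_orbit` — print's «determine uniquely an
  element in each orbit» for `OrbitRel j`, existence ∧ uniqueness.
* §2 (generic, the letters of `Node00.ShearedAveragingFlat`): ★ `shearRIter_eq_one_of_axialTower` — ON AN AXIAL TOWER THE INTRINSIC FACTOR IS TRIVIAL, `S_j(U′) = 1` (block operation `≡ 1 ↦ 1`,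
  contour datum trivial at the centre); `shearedAvgIter_eq_iter_of_axialTower` (`𝒜_j(U′) = M^j(U′)`).
* §3 AT THE RECORD (`avOfRecord` ∕ `contourOfRecord` ∕ `loopAvgBlockOp expMeanLogSU`): ★★ `exists_residual_axialTower_record`; ★★ `exists_axialTower_isBackground` (W.L.O.G. THE MINIMISER OF
  RECORD CARRIES THE AXIAL TOWER: a residual-orbit copy, still a minimiser over the SAME data `V` in `bgReg` — [B11] p.301 «U′_k is a minimum of the functional (5) …», residual version); `shearRIter_avOfRecord_eq_one_of_axialTower`; ★ `hax_inhabited_of_orbit`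
  — for EVERY configuration `U` of EVERY torus of the family and every `j ≤ m + K`, its residual orbit carries `U′ = U^w` such that `(u := 1, U₁ := U′)` meets EVERY hypothesis of
  `Node00.shearedAvgIter_avOfRecord_eq_iter_gauge` ∕ `Node00.iter_avOfRecord_eq_gaugeAct_shearRIter` (axial gauges below `j`, the (1.29) normalisation everywhere) — the honest non-vacuity
  of (88)∕(154)₁∕(r0) beyond the unit configuration.

HONEST FRAMING (binding).  Count-neutral helper; by-name composition of landed theorems (dag-n09-w2 `…N09AxialCovariance181` ∕ `…N09AxialSelectionExists`, r13 `B16Sect1Backgrounds`, r15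
`B15Eq177GaugeInvariance`, dag-p07 `B12GaugeOrbits021`, n07-e `Node00.ShearedAveragingFlat`, this seat's `Node00.ShearedAveragingRecord`).  The (1.29)-normalised LANDAU copy `U₁ = U′^{u⁻¹}`
with `u ≠ 1` — [6] Theorem 2 — is NOT constructed: the witness here has `u = 1` (for it (154)₁ reads `M^j(U′) = M^j(U′)`); uniqueness in (1.15) is
iterated from dag-n09-w2's one-level `eq_one_of_fine_of_axialGauge`.  Nothing of [B11]∕[6]∕[3] analysis asserted; tokens ∕ stub 1 ∕ K0⁷ ∕ K1⁷ NOT closed; N07 ∕ N09 NOT discharged (typed 28∕28 · discharged 5∕27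
unmoved); no summit statement is proved by this seat; one finite `T⁴` programme at fixed `ε`, Bałaban AS PRINTED with locators — the route closes the conditional finite-𝕋⁴ rung
`BalabanLadder.UV` only; NOT continuum ∕ ℝ⁴ ∕ OS ∕ mass gap ∕ Clay.  No `sorry`, no `def`, no `instance`, no `notation`.
-/

noncomputable section

namespace Summit.QuantumFields.YangMills.BalabanUVNodes.N07AxialTowerRepresentative

open Literature.MathematicalPhysics.QuantumFieldTheory.Balaban1983to89
open Literature.MathematicalPhysics.QuantumFieldTheory.Balaban1983to89.Node00
open B12GaugeOrbits021 (IsResidual OrbitRel)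
open B12RTGaugeInvariance254 (liftTransf)
open B16Sect1Backgrounds (toMS iter_gaugeAct)
open B15Eq177GaugeInvariance (blockLift)
open B15DeterminingSets (embIter)
open GaugeField (gaugeAct)
open ExpMeanLog (expMeanLogSU)
open Summit.QuantumFields.YangMills.BalabanUVNodes.N09AxialCovariance181 (exists_fine_axialGauge axialGauge_gaugeAct_liftTransf eq_one_of_fine_of_axialGauge)
open Summit.QuantumFields.YangMills.BalabanUVNodes.N09AxialSelectionExists (isResidual_blockLift_of_fine iter_gaugeAct_blockLift)
open Summit.QuantumFields.YangMills.BalabanUVNodes.N09LiftInvariance29AtRecord (gaugeAct_mem_bgReg)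

/-! ## §1  Generic: block-constant lifts preserve the lower axial gauges; every residual orbit meets the axial tower -/

section Generic

variable {P : Params} {G : Type*} [GaugeGroup G] (av : ∀ i, Averaging P i G) (cd : ∀ i, ContourData P i G)

/-- **Block-constant lifts from level `j` preserve the axial gauges below `j`**: if `M^i(X)`, `i < j`, are block-axial for `cd i`, so are `M^i(X^{ū})` for `ū = blockLift j u`, every
`u : T^{(j)} → G` — since `blockLift (j′+1) u = blockLift j′ (u ∘ blockOf)` (r15, definitional), at the top level `j′` the average is moved by the block-constant `u ∘ blockOf`
(`iter_gaugeAct_blockLift`), which preserves the axial gauge (dag-n09-w2's `axialGauge_gaugeAct_liftTransf`), and below `j′` the induction hypothesis applies. Standing range `j ≤ m + K`.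
[cite: Balaban1985RegularSpaces, (1.15) p.78; Balaban1985Variational, (181) p.307] -/
theorem axialTower_gaugeAct_blockLift :
    ∀ (j : ℕ), j ≤ P.m + P.K → ∀ (u : GaugeTransf P j G) (X : GaugeField P 0 G),
      (∀ i < j, AxialGauge (cd i) (Averaging.iter av i X)) →
        ∀ i < j, AxialGauge (cd i) (Averaging.iter av i (gaugeAct (blockLift j u) X))
  | 0, _, _, _, _, i, hi => absurd hi (Nat.not_lt_zero i)
  | j + 1, hj, u, X, hax, i, hi => by
      have hj' : j ≤ P.m + P.K := Nat.le_of_succ_le hj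
      have hbl : blockLift (j + 1) u = blockLift j (liftTransf u) := rfl
      rw [hbl]
      rcases Nat.lt_succ_iff_lt_or_eq.mp hi with hlt | heq
      · exact axialTower_gaugeAct_blockLift j hj' (liftTransf u) X (fun i' hi' => hax i' (Nat.lt_succ_of_lt hi')) i hlt
      · subst heq
        rw [iter_gaugeAct_blockLift av hj' (liftTransf u) X]
        exact axialGauge_gaugeAct_liftTransf hj (cd i) u (hax i (Nat.lt_succ_self i))

/-- ★★ **EVERY RESIDUAL ORBIT MEETS THE AXIAL TOWER** — the existence half of [6] (1.15) with the restricted group (1.14), single-domain reading, for ANY averaging family and ANY contour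
family: for `j ≤ m + K` and every configuration `U` of `T_η` there is a gauge transformation `w`, trivial on `T^{(j)} ⊂ T_η` (`IsResidual j w`), such that `M^i(U^w)` is block-axial for
`cd i` at EVERY level `i < j`.  Induction on `j`: fix the tower below `j` (hypothesis), axial-gauge the new top average `M^j(U^{w₀})` by a FINE transformation `u` of `T^{(j)}`
(dag-n09-w2's `exists_fine_axialGauge`), lift it block-constantly (`blockLift j u`: residual of level `j+1` by `isResidual_blockLift_of_fine`, moving `M^j` by `u` itself by
`iter_gaugeAct_blockLift`, harmless below `j` by `axialTower_gaugeAct_blockLift`). [cite: Balaban1985RegularSpaces, (1.15) p.78; Balaban1985Variational, p.300 (Sect. F, «U′_k ∈ Ax_k(□̃(k), 1)»)] -/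
theorem exists_residual_axialTower :
    ∀ (j : ℕ), j ≤ P.m + P.K → ∀ U : GaugeField P 0 G,
      ∃ w : GaugeTransf P 0 G, IsResidual j w ∧ ∀ i < j, AxialGauge (cd i) (Averaging.iter av i (gaugeAct w U))
  | 0, _, _ => ⟨fun _ => 1, fun _ => rfl, fun i hi => absurd hi (Nat.not_lt_zero i)⟩
  | j + 1, hj, U => by
      have hj' : j ≤ P.m + P.K := Nat.le_of_succ_le hj
      obtain ⟨w₀, hres, hax⟩ := exists_residual_axialTower j hj' U
      obtain ⟨u, hfine, haxj⟩ := exists_fine_axialGauge hj (cd j) (Averaging.iter av j (gaugeAct w₀ U))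
      refine ⟨fun x => blockLift j u x * w₀ x, fun y => ?_, fun i hi => ?_⟩
      · show blockLift j u (embIter (j + 1) y) * w₀ (embIter (j + 1) y) = 1
        rw [isResidual_blockLift_of_fine hj' hfine y, hres.succ y, mul_one]
      · have hcomp : gaugeAct (fun x => blockLift j u x * w₀ x) U = gaugeAct (blockLift j u) (gaugeAct w₀ U) :=
          (B16Sect1Backgrounds.gaugeAct_gaugeAct _ _ _).symm
        rw [hcomp]
        rcases Nat.lt_succ_iff_lt_or_eq.mp hi with hlt | heq
        · exact axialTower_gaugeAct_blockLift av cd j hj' u (gaugeAct w₀ U) hax i hlt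
        · subst heq
          rw [iter_gaugeAct_blockLift av hj' u]
          exact haxj

/-- The same without the residual clause: every gauge orbit of `T_η` contains an axial tower of depth `j ≤ m + K`. [cite: Balaban1985RegularSpaces, (1.15) p.78] -/
theorem exists_axialTower {j : ℕ} (hj : j ≤ P.m + P.K) (U : GaugeField P 0 G) :
    ∃ w : GaugeTransf P 0 G, ∀ i < j, AxialGauge (cd i) (Averaging.iter av i (gaugeAct w U)) :=
  let ⟨w, _, hw⟩ := exists_residual_axialTower av cd j hj U
  ⟨w, hw⟩

/-- ★ **UNIQUENESS half of [6] (1.15) with (1.14)**, all levels at once: if `U` and `U^w` BOTH have block-axial averages at every level `i < j` (`j ≤ m + K`) and `w` is residual of level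
`j` («`u = 1` on `T^{(j)}`»), then `w = 1` — downward induction: the level-`j` restriction `w↾T^{(j)}` is fine and carries the axial `M^j(U)` to the axial `M^j(U^w)` (r13 `iter_gaugeAct`),
so it is trivial by dag-n09-w2's one-level `eq_one_of_fine_of_axialGauge`, i.e. `w` is residual of level `j − 1`; iterate down to level `0`. [cite: Balaban1985RegularSpaces, (1.14)–(1.15) p.78 («determine uniquely an element in each orbit»)] -/
theorem eq_one_of_residual_of_axialTower :
    ∀ (j : ℕ), j ≤ P.m + P.K → ∀ (U : GaugeField P 0 G) (w : GaugeTransf P 0 G), IsResidual j w →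
      (∀ i < j, AxialGauge (cd i) (Averaging.iter av i U)) →
        (∀ i < j, AxialGauge (cd i) (Averaging.iter av i (gaugeAct w U))) → w = fun _ => 1
  | 0, _, _, w, hres, _, _ => (B12GaugeOrbits021.isResidual_zero_iff w).mp hres
  | j + 1, hj, U, w, hres, hax, haxw => by
      have hj' : j ≤ P.m + P.K := Nat.le_of_succ_le hj
      have hfine : ∀ y : Site P (j + 1), toMS w j (emb y) = 1 := fun y => by
        show w (embIter j (emb y)) = 1
        exact hres y
      have haxj : AxialGauge (cd j) (gaugeAct (toMS w j) (Averaging.iter av j U)) := by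
        rw [← iter_gaugeAct av w U j hj']
        exact haxw j (Nat.lt_succ_self j)
      have hj0 : toMS w j = fun _ => 1 := eq_one_of_fine_of_axialGauge (cd j) (hax j (Nat.lt_succ_self j)) hfine haxj
      exact eq_one_of_residual_of_axialTower j hj' U w ((B12GaugeOrbits021.isResidual_iff_toMS j w).mpr hj0)
        (fun i hi => hax i (Nat.lt_succ_of_lt hi)) (fun i hi => haxw i (Nat.lt_succ_of_lt hi))

/-- Hence TWO configurations of one residual orbit of level `j` with axial towers of depth `j` COINCIDE. [cite: Balaban1985RegularSpaces, (1.15) p.78] -/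
theorem axialTower_unique_of_orbitRel {j : ℕ} (hj : j ≤ P.m + P.K) {U₁ U₂ : GaugeField P 0 G} (h : OrbitRel j U₁ U₂)
    (h₁ : ∀ i < j, AxialGauge (cd i) (Averaging.iter av i U₁)) (h₂ : ∀ i < j, AxialGauge (cd i) (Averaging.iter av i U₂)) : U₁ = U₂ := by
  obtain ⟨u, hres, rfl⟩ := h
  have hu : u = fun _ => 1 := eq_one_of_residual_of_axialTower av cd j hj U₁ u hres h₁ h₂
  subst hu
  exact (B12RTGaugeInvariance254.gaugeAct_one' U₁).symm

/-- ★★ **«these equations together with (1.14) … determine uniquely an element in each orbit» — EXISTENCE AND UNIQUENESS, generic**: every residual orbit of level `j ≤ m + K` (dag-p07's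
`OrbitRel j`) contains EXACTLY ONE configuration whose averages `M^i`, `i < j`, are all block-axial — for any averaging family and any contour family on the tori of `Setup`, any gauge group.
[cite: Balaban1985RegularSpaces, (1.14)–(1.15) p.78] -/
theorem existsUnique_axialTower_in_orbit {j : ℕ} (hj : j ≤ P.m + P.K) (U : GaugeField P 0 G) :
    ∃! U' : GaugeField P 0 G, OrbitRel j U U' ∧ ∀ i < j, AxialGauge (cd i) (Averaging.iter av i U') := by
  obtain ⟨w, hres, hax⟩ := exists_residual_axialTower av cd j hj U
  refine ⟨gaugeAct w U, ⟨⟨w, hres, rfl⟩, hax⟩, fun U₂ hU₂ => ?_⟩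
  exact (axialTower_unique_of_orbitRel av cd hj ((OrbitRel.symm ⟨w, hres, rfl⟩).trans hU₂.1) hax hU₂.2).symm

/-! ## §2  Generic, in the letters of `Node00.ShearedAveragingFlat`: on an axial tower the intrinsic factor `S_j` is trivial -/

variable (𝓔 : ∀ i, Site P (i + 1) → (Site P i → G) → G)

/-- ★ **`S_j(U′) = 1` ON AN AXIAL TOWER**: if `M^i(U′)` is block-axial for `cd i` at every level `i < j`, the (85) intrinsic factor `shearRIter av cd 𝓔 U′ j` is identically `1` — for a block
operation sending families `≡ 1` on the block to `1` (`h𝓔1`; the printed `exp[mean log]`: `Node00.loopAvgBlockOp_congr_one`) and a contour datum trivial at the centre (`hctr`).  Induction: inside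
`𝓔_y` the family is `1⁻¹·U′^{(i)}(Γ_{y,x})·1 = 1` off the centre by axiality and at the centre by `hctr`. [cite: Balaban1985Averaging, (85) p.31, (64)–(67) p.29] -/
theorem shearRIter_eq_one_of_axialTower
    (h𝓔1 : ∀ (i : ℕ) (y : Site P (i + 1)) (f : Site P i → G), (∀ x, blockOf x = y → f x = 1) → 𝓔 i y f = 1)
    (hctr : ∀ (i : ℕ) (U : GaugeField P i G) (y : Site P (i + 1)), (cd i).holTo U y (emb y) = 1) {U' : GaugeField P 0 G} :
    ∀ j : ℕ, (∀ i < j, AxialGauge (cd i) (Averaging.iter av i U')) → shearRIter av cd 𝓔 U' j = fun _ => 1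
  | 0, _ => rfl
  | j + 1, hax => by
      have ih := shearRIter_eq_one_of_axialTower h𝓔1 hctr j (fun i hi => hax i (Nat.lt_succ_of_lt hi))
      funext y
      show shearRIter av cd 𝓔 U' j (emb y) *
          𝓔 j y (fun x => (shearRIter av cd 𝓔 U' j (emb y))⁻¹ * (cd j).holTo (Averaging.iter av j U') y x * shearRIter av cd 𝓔 U' j x) = 1
      rw [ih]
      simp only [inv_one, one_mul, mul_one]
      refine h𝓔1 j y _ fun x hx => ?_
      by_cases hxy : x = emb y
      · subst hxy
        exact hctr j _ y
      · exact hax j (Nat.lt_succ_self j) y x hx hxy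

/-- Hence on an axial tower the SHEARED `j`-fold average (88) is the plain one: `𝒜_j(U′) = M^j(U′)`. [cite: Balaban1985Averaging, (88) p.31] -/
theorem shearedAvgIter_eq_iter_of_axialTower
    (h𝓔1 : ∀ (i : ℕ) (y : Site P (i + 1)) (f : Site P i → G), (∀ x, blockOf x = y → f x = 1) → 𝓔 i y f = 1)
    (hctr : ∀ (i : ℕ) (U : GaugeField P i G) (y : Site P (i + 1)), (cd i).holTo U y (emb y) = 1) {U' : GaugeField P 0 G} {j : ℕ}
    (hax : ∀ i < j, AxialGauge (cd i) (Averaging.iter av i U')) :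
    shearedAvgIter av cd 𝓔 U' j = Averaging.iter av j U' := by
  funext c
  unfold shearedAvgIter
  rw [shearRIter_eq_one_of_axialTower av cd 𝓔 h𝓔1 hctr j hax]
  simp

end Generic

/-! ## §3  At the record: `avOfRecord F N K`, `contourOfRecord F N K`, `loopAvgBlockOp expMeanLogSU` -/

section Record

variable (F : T4Continuum.T4Family) (N : ℕ) [NeZero N]

/-- ★★ **[B11] Sect. F's first step AT THE RECORD**: for every torus `K` of the family, every `j ≤ m + K` and every configuration `U` (in particular the minimiser `U_k` of record), the
residual orbit of `U` contains `U′ = U^w` whose averages of record `M^i(U′)`, `i < j`, are block-axial for the contour datum of record at every level. [cite: Balaban1985Variational, p.300 (Sect. F); Balaban1985RegularSpaces, (1.15) p.78] -/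
theorem exists_residual_axialTower_record (K : ℕ) {j : ℕ} (hj : j ≤ (F.P K).m + (F.P K).K) (U : GaugeField (F.P K) 0 (SU N)) :
    ∃ w : GaugeTransf (F.P K) 0 (SU N), IsResidual j w ∧
      ∀ i < j, AxialGauge (contourOfRecord F N K i) (Averaging.iter (avOfRecord F N K) i (gaugeAct w U)) :=
  exists_residual_axialTower _ _ j hj U

/-- ★★ **«The configuration U′_k is a minimum of the functional (5) in the space …» AT THE RECORD, residual version** ([B11] p. 301): every minimiser `U₀` of the Wilson action of record on
`{M^k(U) = V} ∩ bgReg` (NODE 00's (0.21) contract `IsBackground (avOfRecord F N K) (bgReg F N K k ε) k V`) has, IN ITS RESIDUAL ORBIT of level `k`, a minimiser `U′` OVER THE SAME DATA `V`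
whose averages `M^i(U′)`, `i < k`, are block-axial for the contour datum of record at every level — W.L.O.G. the minimiser of record carries the axial tower of Sect. F's first step (the
residual transformation keeps `M^k` and the class `bgReg`: dag-p07's `isBackground_gaugeAct`, dag-n09-w2's `gaugeAct_mem_bgReg`; print's own axial gauge is not residual and changes
`V` into `V′`, (147) — here `V` is unchanged). [cite: Balaban1985Variational, p.300–301 (Sect. F, (144)–(150)); Balaban1987RG1, (0.21) p.256] -/
theorem exists_axialTower_isBackground (K : ℕ) {k : ℕ} (hk : k ≤ (F.P K).m + (F.P K).K) {ε : ℝ} {V : GaugeField (F.P K) k (SU N)}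
    {U₀ : GaugeField (F.P K) 0 (SU N)} (h : IsBackground (avOfRecord F N K) (bgReg F N K k ε) k V U₀) :
    ∃ U' : GaugeField (F.P K) 0 (SU N), OrbitRel k U₀ U' ∧ IsBackground (avOfRecord F N K) (bgReg F N K k ε) k V U' ∧
      ∀ i < k, AxialGauge (contourOfRecord F N K i) (Averaging.iter (avOfRecord F N K) i U') := by
  obtain ⟨w, hres, hax⟩ := exists_residual_axialTower_record F N K hk U₀
  exact ⟨gaugeAct w U₀, ⟨w, hres, rfl⟩,
    B12GaugeOrbits021.isBackground_gaugeAct hk (fun u _ U hU => gaugeAct_mem_bgReg u U hU) h hres, hax⟩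

/-- `S_j(U′) = 1` at the record on an axial tower of the contour datum of record. [cite: Balaban1985Averaging, (85) p.31] -/
theorem shearRIter_avOfRecord_eq_one_of_axialTower (K : ℕ) {U' : GaugeField (F.P K) 0 (SU N)} {j : ℕ}
    (hax : ∀ i < j, AxialGauge (contourOfRecord F N K i) (Averaging.iter (avOfRecord F N K) i U')) :
    shearRIter (avOfRecord F N K) (contourOfRecord F N K) (loopAvgBlockOp expMeanLogSU) U' j = fun _ => 1 :=
  shearRIter_eq_one_of_axialTower _ _ _ (loopAvgBlockOp_congr_one expMeanLogSU (expMeanLogSU_E_one' N)) (holTo_contourOfRecord_emb F N K) j hax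

/-- ★ **THE `hax` BINDERS ARE INHABITED IN EVERY RESIDUAL ORBIT** (A6 for `Node00.shearedAvgIter_avOfRecord_eq_iter_gauge` ∕ `Node00.iter_avOfRecord_eq_gaugeAct_shearRIter` beyond the unit
configuration): for every `U` and `j ≤ m + K` there is a residual `w` such that, with `U′ := U^w`, the pair `(u := 1, U₁ := U′)` satisfies the block axial gauges at every level `< j`
AND the (81)∕(1.29) normalisation at EVERY site of `T^{(j)}` — and for it the sheared average of record IS the plain average of record, `𝒜_j(U′) = M^j(U′)`.
[cite: Balaban1985Variational, (152)–(154) pp.301–302; Balaban1985RegularSpaces, (1.15) p.78] -/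
theorem hax_inhabited_of_orbit (K : ℕ) {j : ℕ} (hj : j ≤ (F.P K).m + (F.P K).K) (U : GaugeField (F.P K) 0 (SU N)) :
    ∃ w : GaugeTransf (F.P K) 0 (SU N), IsResidual j w ∧
      (∀ i < j, AxialGauge (contourOfRecord F N K i)
        (Averaging.iter (avOfRecord F N K) i (gaugeAct (fun _ => (1 : SU N)) (gaugeAct w U)))) ∧
      (∀ y : Site (F.P K) j, gaugeAvgIter (P := F.P K) (loopAvgBlockOp expMeanLogSU) (fun _ => (1 : SU N)) j y = 1) ∧
      shearedAvgIter (avOfRecord F N K) (contourOfRecord F N K) (loopAvgBlockOp expMeanLogSU) (gaugeAct w U) j =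
        Averaging.iter (avOfRecord F N K) j (gaugeAct w U) := by
  obtain ⟨w, hres, hax⟩ := exists_residual_axialTower_record F N K hj U
  refine ⟨w, hres, ?_, fun y => ?_, ?_⟩
  · rw [B12RTGaugeInvariance254.gaugeAct_one']
    exact hax
  · rw [gaugeAvgIter_loopAvgBlockOp_one (P := F.P K) expMeanLogSU (expMeanLogSU_E_one' N) j]
  · exact shearedAvgIter_eq_iter_of_axialTower _ _ _ (loopAvgBlockOp_congr_one expMeanLogSU (expMeanLogSU_E_one' N))
      (holTo_contourOfRecord_emb F N K) hax

end Record

end Summit.QuantumFields.YangMills.BalabanUVNodes.N07AxialTowerRepresentative
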